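import Summits.CriticalPhenomena.Ising3DConformalLimit.Theorems.PlantedPinningMoebiusLimitExistsTransitiveJet
import Summits.CriticalPhenomena.Ising3DConformalLimit.Theorems.PlantedPinningMoebiusLimitExistsJetCompEquiv
import Summits.CriticalPhenomena.Ising3DConformalLimit.Theorems.PlantedPinningMoebiusLimitExistsHessianKernel
import Summits.CriticalPhenomena.Ising3DConformalLimit.Theorems.PlantedPinningMoebiusLimitExistsEulerAt
import Summits.CriticalPhenomena.Ising3DConformalLimit.Theorems.PlantedPinningMoebiusLimitExistsAxialRotationGenerator
import Mathlib.Analysis.Calculus.ContDiff.Defs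
import HarnessLib

/-!
# Order-2 KERNELS of the Ising₃ Ward-defect jet and its invariance under the stabiliser
(crux `MoebiusLimitExists`, stmt-CriticalPhenomena-1344, line `Sketch` v24/v25, lead prover-line-stmt-CriticalPhenomena-1344-c20-0;
THEOREM-ONLY, `--supports stmt-CriticalPhenomena-1344`)

Skeletons v20–v23 (`…TransitiveJet.lean` p166648, `…JetParity.lean` p167057) leave the crux as `item 1981 ∧ 7⁗_jet≥2,odd`: the
odd-vertical-parity Taylor coefficients of order `k ≥ 2` of the pointwise `K_{e₀}` defect
`D_n(x) = DS_n(x)[(‖xᵢ‖²e₀ − 2⟪e₀,xᵢ⟫xᵢ)ᵢ] − 2Δ(Σ⟪e₀,xᵢ⟫)S_n(x)` at the unit regular horizontal `n`-gon `P_n`.  This file records the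
remaining FREE structure of that list coming from the conformal algebra and from the stabiliser of `P_n`:

* (pure) `defectK1_axial_invariant`: the `K_{e₀}` defect of an `O(3)`-invariant level is invariant under isometries fixing `e₀` (Z1);
  `jetK1_comp_symmetry`: if such an isometry maps `x₀` to its relabelling by `σ`, the whole Taylor jet at `x₀` is invariant under
  `m ↦ (R̂m)∘σ⁻¹` in every slot (P1 p166830) — at `P_n` the dihedral equivariance of every coefficient
  (`limit_jetK1_rotation_invariant_at_regularPolygon`, N1b's rotation by `2π/n`);
* (Ising₃ limits) the first-order identities of the defect at every non-coincident `y` — translation `DD_n(y)[ĉ] = 0`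
  (`limit_defect_translate` + Y3), Euler `DD_n(y)[y] = (1 − nΔ) D_n(y)` (`limit_defect_dilate` + E1 p167468), axial rotation
  `DD_n(y)[(⟪e₂,yᵢ⟫e₁ − ⟪e₁,yᵢ⟫e₂)ᵢ] = 0` (Z3' p167615) — i.e. `[P,K] ∈ span(D,M)`, `[D,K] = K`, `[M₁₂,K₀] = 0` read on the defect;
* `limit_hessian_defectK1_kernels`: at every non-coincident `x₀` with `DD_n(x₀) = 0` the Hessian of `D_n` kills, in either slot, every
  constant direction `ĉ`, the dilation direction `x₀` and the axial-rotation direction `M̂x₀` (K0 p167500: differentiate the identities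
  at the critical point); at `P_n` unconditionally (`limit_hessian_defectK1_kernels_at_regularPolygon`, `DD_n(P_n) = 0` by transitivity).

Reading at `(n, k) = (4, 2)`: of the `12 × 12` Hessian of `D_4` at the square, the `HH` and `VV` blocks vanish (parity), the rows/columns
of the `3` translations, the dilation and the axial rotation vanish, and the rest is `D_4`-equivariant — lead c19's count (≤ 2 free
entries) is now a chain of tree theorems up to the final finite bookkeeping.  No mechanism for the surviving numbers is claimed.
References: Di Francesco–Mathieu–Sénéchal 1997 §4.1 (4.18)–(4.19), §4.3.1 [FrancescoMathieuSenechal1997].  No definitions, no `sorry`.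
-/

noncomputable section

namespace Summit.CriticalPhenomena.Ising3DConformalLimit.MoebiusLimitExistsHessianKernels

open Filter Topology Set Function
open Literature.Probability.LatticeModels
open Summit.CriticalPhenomena.Ising3DConformalLimit.MoebiusLimitExistsSketchV16
  (stub_defect_rotate stub_defect_perm stub_fderiv_apply_eq_zero_of_eventually_line)
open Summit.CriticalPhenomena.Ising3DConformalLimit.MoebiusLimitExistsSketchV20 (stub_regularPolygon_mem_nonCoincident stub_regularPolygon_rotation)
open Summit.CriticalPhenomena.Ising3DConformalLimit.MoebiusLimitExistsSketchV22 (stub_iteratedFDeriv_comp_continuousLinearEquiv)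
open Summit.CriticalPhenomena.Ising3DConformalLimit.MoebiusLimitExistsSketchV24
  (stub_hessian_apply_eq_zero_of_fderiv_identity stub_fderiv_self_of_homogeneous_at stub_fderiv_axialRotationGenerator)
open Summit.CriticalPhenomena.Ising3DConformalLimit.MoebiusLimitExistsLocalWard (analyticOnNhd_limit analyticOnNhd_defect)
open Summit.CriticalPhenomena.Ising3DConformalLimit.MoebiusLimitExistsDefectSymmetry (limit_defect_translate limit_defect_dilate)
open Summit.CriticalPhenomena.Ising3DConformalLimit.Cruxes.InversionUpgradeNormalised.FreeEndpointGaussianClosure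
  (isPermutationSymmetric_of_limit)
open Summit.CriticalPhenomena.Ising3DConformalLimit.MoebiusLimitExistsTransitiveJet (limit_fderiv_defectK1_eq_zero_at_regularPolygon)

/-! ## A (pure). Invariance of the `K_{e₀}` defect under isometries fixing `e₀`; jet invariance under the stabiliser -/

/-- **The `K_{e₀}` defect of an `O(3)`-invariant level is INVARIANT under the diagonal action of every linear isometry fixing `e₀`**
(Z1 with `R e₀ = e₀`). [cite: FrancescoMathieuSenechal1997, §4.1 (4.18)–(4.19)] -/
theorem defectK1_axial_invariant (n : ℕ) (F : (Fin n → EuclideanSpace ℝ (Fin 3)) → ℝ) (Δ : ℝ)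
    (hrot : ∀ (R : EuclideanSpace ℝ (Fin 3) ≃ₗᵢ[ℝ] EuclideanSpace ℝ (Fin 3)) (y : Fin n → EuclideanSpace ℝ (Fin 3)),
      F (fun i => R (y i)) = F y)
    (R : EuclideanSpace ℝ (Fin 3) ≃ₗᵢ[ℝ] EuclideanSpace ℝ (Fin 3))
    (hR0 : R (EuclideanSpace.single 0 1) = EuclideanSpace.single 0 1) (x : Fin n → EuclideanSpace ℝ (Fin 3)) :
    fderiv ℝ F (fun i => R (x i))
        (fun i => ‖R (x i)‖ ^ 2 • (EuclideanSpace.single 0 1 : EuclideanSpace ℝ (Fin 3)) -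
          (2 * inner ℝ (EuclideanSpace.single 0 1 : EuclideanSpace ℝ (Fin 3)) (R (x i))) • R (x i)) -
        2 * Δ * (∑ i, inner ℝ (EuclideanSpace.single 0 1 : EuclideanSpace ℝ (Fin 3)) (R (x i))) * F (fun i => R (x i)) =
      fderiv ℝ F x (fun i => ‖x i‖ ^ 2 • (EuclideanSpace.single 0 1 : EuclideanSpace ℝ (Fin 3)) -
          (2 * inner ℝ (EuclideanSpace.single 0 1 : EuclideanSpace ℝ (Fin 3)) (x i)) • x i) -
        2 * Δ * (∑ i, inner ℝ (EuclideanSpace.single 0 1 : EuclideanSpace ℝ (Fin 3)) (x i)) * F x := by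
  have h := stub_defect_rotate n F Δ R (fun y => hrot R y) (EuclideanSpace.single 0 1) x
  rw [hR0] at h
  exact h

/-- **Jet invariance under the stabiliser.**  If a linear isometry `R` fixing `e₀` maps `x₀` to its relabelling by `σ` (`R x₀ᵢ = x₀_{σ i}`),
then the Taylor jet at `x₀` of the `K_{e₀}` defect of every `O(3) × S_n`-invariant level is invariant under `m ↦ (R̂m)∘σ⁻¹` in every slot
(the defect is invariant under the continuous linear equivalence `y ↦ (R̂y)∘σ⁻¹`, which fixes `x₀`; P1).  At the regular polygon this is
the dihedral `D_n`-equivariance of the jet. [cite: FrancescoMathieuSenechal1997, §4.1 (4.18)–(4.19)] -/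
theorem jetK1_comp_symmetry (n : ℕ) (F : (Fin n → EuclideanSpace ℝ (Fin 3)) → ℝ) (Δ : ℝ)
    (hrot : ∀ (R : EuclideanSpace ℝ (Fin 3) ≃ₗᵢ[ℝ] EuclideanSpace ℝ (Fin 3)) (y : Fin n → EuclideanSpace ℝ (Fin 3)),
      F (fun i => R (y i)) = F y)
    (hperm : ∀ (σ : Equiv.Perm (Fin n)) (y : Fin n → EuclideanSpace ℝ (Fin 3)), F (y ∘ σ) = F y)
    (R : EuclideanSpace ℝ (Fin 3) ≃ₗᵢ[ℝ] EuclideanSpace ℝ (Fin 3))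
    (hR0 : R (EuclideanSpace.single 0 1) = EuclideanSpace.single 0 1) (σ : Equiv.Perm (Fin n))
    (x₀ : Fin n → EuclideanSpace ℝ (Fin 3)) (hRx : ∀ i, R (x₀ i) = x₀ (σ i))
    (k : ℕ) (m : Fin k → Fin n → EuclideanSpace ℝ (Fin 3)) :
    iteratedFDeriv ℝ k (fun x : Fin n → EuclideanSpace ℝ (Fin 3) =>
        fderiv ℝ F x (fun i => ‖x i‖ ^ 2 • (EuclideanSpace.single 0 1 : EuclideanSpace ℝ (Fin 3)) -
          (2 * inner ℝ (EuclideanSpace.single 0 1 : EuclideanSpace ℝ (Fin 3)) (x i)) • x i) -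
        2 * Δ * (∑ i, inner ℝ (EuclideanSpace.single 0 1 : EuclideanSpace ℝ (Fin 3)) (x i)) * F x) x₀
        (fun j i => R (m j (σ.symm i))) =
      iteratedFDeriv ℝ k (fun x : Fin n → EuclideanSpace ℝ (Fin 3) =>
        fderiv ℝ F x (fun i => ‖x i‖ ^ 2 • (EuclideanSpace.single 0 1 : EuclideanSpace ℝ (Fin 3)) -
          (2 * inner ℝ (EuclideanSpace.single 0 1 : EuclideanSpace ℝ (Fin 3)) (x i)) • x i) -
        2 * Δ * (∑ i, inner ℝ (EuclideanSpace.single 0 1 : EuclideanSpace ℝ (Fin 3)) (x i)) * F x) x₀ m := by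
  set e0 : EuclideanSpace ℝ (Fin 3) := EuclideanSpace.single 0 1 with he0
  set D : (Fin n → EuclideanSpace ℝ (Fin 3)) → ℝ := fun x =>
    fderiv ℝ F x (fun i => ‖x i‖ ^ 2 • e0 - (2 * inner ℝ e0 (x i)) • x i) - 2 * Δ * (∑ i, inner ℝ e0 (x i)) * F x with hD
  -- the symmetry as a continuous linear equivalence `g y = (R̂ y) ∘ σ⁻¹`
  set g : (Fin n → EuclideanSpace ℝ (Fin 3)) ≃L[ℝ] (Fin n → EuclideanSpace ℝ (Fin 3)) :=
    (ContinuousLinearEquiv.piCongrRight fun _ : Fin n => R.toContinuousLinearEquiv).trans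
      (LinearEquiv.funCongrLeft ℝ (EuclideanSpace ℝ (Fin 3)) σ.symm).toContinuousLinearEquiv with hg
  have hgapply : ∀ y : Fin n → EuclideanSpace ℝ (Fin 3), g y = fun i => R (y (σ.symm i)) := fun y => rfl
  have hgx₀ : g x₀ = x₀ := by
    rw [hgapply]; funext i; rw [hRx, Equiv.apply_symm_apply]
  -- `D ∘ g = D`: Z1 (isometry fixing `e₀`) then Z2 (relabelling)
  have hinv : D ∘ g = D := funext fun y => by
    have h1 := defectK1_axial_invariant n F Δ hrot R hR0 (y ∘ σ.symm)
    have h2 := stub_defect_perm n F Δ σ.symm (fun z => hperm σ.symm z) e0 y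
    simp only [comp_apply, hgapply]
    simp only [hD, comp_apply] at h1 h2 ⊢
    rw [h1, h2]
  have h := stub_iteratedFDeriv_comp_continuousLinearEquiv n k D g x₀ m
  rw [hinv, hgx₀] at h
  have hgm : (fun j => g (m j)) = fun j i => R (m j (σ.symm i)) := funext fun j => hgapply (m j)
  rw [hgm] at h
  exact h.symm

/-! ## B (Ising₃ limits). First-order symmetry identities of the defect, and the order-2 KERNELS -/

section Limit

variable {ρ : ℝ → ℝ} {Δ : ℝ} {S : CorrFamily 3}

/-- **Translation: `DD_n(y)[ĉ] = 0`** at every non-coincident `y` (the defect is translation invariant on `NonCoincident`,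
`limit_defect_translate`; Y3 on `z ↦ D_n z − D_n y`). [cite: FrancescoMathieuSenechal1997, §4.1 (4.19)] -/
theorem limit_fderiv_defectK1_const_eq_zero (hρ : ∀ δ ∈ Set.Ioc (0:ℝ) 1, 0 < ρ δ)
    (hlim : HasPointwiseScalingLimit (criticalCorr 3) ρ S)
    (hnorm : ∀ n z, z ∉ NonCoincident 3 n → S n z = 0) (hnd : IsNondegenerateTwoPoint S)
    (heuc : IsEuclideanInvariant S) (hsc : IsScaleCovariant Δ S)
    {n : ℕ} {y : Fin n → EuclideanSpace ℝ (Fin 3)} (hy : y ∈ NonCoincident 3 n) (c : EuclideanSpace ℝ (Fin 3)) :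
    fderiv ℝ (fun x : Fin n → EuclideanSpace ℝ (Fin 3) =>
        fderiv ℝ (S n) x (fun i => ‖x i‖ ^ 2 • (EuclideanSpace.single 0 1 : EuclideanSpace ℝ (Fin 3)) -
          (2 * inner ℝ (EuclideanSpace.single 0 1 : EuclideanSpace ℝ (Fin 3)) (x i)) • x i) -
        2 * Δ * (∑ i, inner ℝ (EuclideanSpace.single 0 1 : EuclideanSpace ℝ (Fin 3)) (x i)) * S n x) y (fun _ => c) = 0 := by
  set e0 : EuclideanSpace ℝ (Fin 3) := EuclideanSpace.single 0 1 with he0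
  set D : (Fin n → EuclideanSpace ℝ (Fin 3)) → ℝ := fun x =>
    fderiv ℝ (S n) x (fun i => ‖x i‖ ^ 2 • e0 - (2 * inner ℝ e0 (x i)) • x i) - 2 * Δ * (∑ i, inner ℝ e0 (x i)) * S n x with hD
  have hDdiff : DifferentiableAt ℝ D y :=
    (analyticOnNhd_defect (analyticOnNhd_limit hρ hlim hnorm hnd heuc hsc n) Δ e0 y hy).differentiableAt
  -- `D (y + t ĉ) = D y` for every `t`
  have hconst : ∀ t : ℝ, D (y + t • fun _ => c) = D y := fun t => by
    have h := limit_defect_translate hρ hlim hnorm hnd heuc hsc hy e0 (t • c)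
    have hcfg : (y + t • fun _ : Fin n => c) = fun i => y i + t • c := funext fun i => by simp
    rw [hcfg]
    simpa only [hD] using h
  have h0 : fderiv ℝ (fun z => D z - D y) y (fun _ => c) = 0 :=
    stub_fderiv_apply_eq_zero_of_eventually_line n (fun z => D z - D y) y (fun _ => c) (hDdiff.sub_const _)
      (Filter.Eventually.of_forall fun t => by simp only [hconst t, sub_self])
  rwa [fderiv_sub_const] at h0

/-- **Dilation: the Euler identity of the defect, `DD_n(y)[y] = (1 − nΔ) D_n(y)`** at every non-coincident `y` (`limit_defect_dilate` + E1).
[cite: FrancescoMathieuSenechal1997, §4.1 (4.19)] -/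
theorem limit_fderiv_defectK1_self (hρ : ∀ δ ∈ Set.Ioc (0:ℝ) 1, 0 < ρ δ)
    (hlim : HasPointwiseScalingLimit (criticalCorr 3) ρ S)
    (hnorm : ∀ n z, z ∉ NonCoincident 3 n → S n z = 0) (hnd : IsNondegenerateTwoPoint S)
    (heuc : IsEuclideanInvariant S) (hsc : IsScaleCovariant Δ S)
    {n : ℕ} {y : Fin n → EuclideanSpace ℝ (Fin 3)} (hy : y ∈ NonCoincident 3 n) :
    fderiv ℝ (fun x : Fin n → EuclideanSpace ℝ (Fin 3) =>
        fderiv ℝ (S n) x (fun i => ‖x i‖ ^ 2 • (EuclideanSpace.single 0 1 : EuclideanSpace ℝ (Fin 3)) -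
          (2 * inner ℝ (EuclideanSpace.single 0 1 : EuclideanSpace ℝ (Fin 3)) (x i)) • x i) -
        2 * Δ * (∑ i, inner ℝ (EuclideanSpace.single 0 1 : EuclideanSpace ℝ (Fin 3)) (x i)) * S n x) y y =
      (1 - (n : ℝ) * Δ) *
        (fderiv ℝ (S n) y (fun i => ‖y i‖ ^ 2 • (EuclideanSpace.single 0 1 : EuclideanSpace ℝ (Fin 3)) -
          (2 * inner ℝ (EuclideanSpace.single 0 1 : EuclideanSpace ℝ (Fin 3)) (y i)) • y i) -
        2 * Δ * (∑ i, inner ℝ (EuclideanSpace.single 0 1 : EuclideanSpace ℝ (Fin 3)) (y i)) * S n y) := by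
  set e0 : EuclideanSpace ℝ (Fin 3) := EuclideanSpace.single 0 1 with he0
  set D : (Fin n → EuclideanSpace ℝ (Fin 3)) → ℝ := fun x =>
    fderiv ℝ (S n) x (fun i => ‖x i‖ ^ 2 • e0 - (2 * inner ℝ e0 (x i)) • x i) - 2 * Δ * (∑ i, inner ℝ e0 (x i)) * S n x with hD
  have hDdiff : DifferentiableAt ℝ D y :=
    (analyticOnNhd_defect (analyticOnNhd_limit hρ hlim hnorm hnd heuc hsc n) Δ e0 y hy).differentiableAt
  refine stub_fderiv_self_of_homogeneous_at n D (1 - (n : ℝ) * Δ) y hDdiff fun t ht => ?_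
  have h := limit_defect_dilate hρ hlim hnorm hnd heuc hsc hy e0 ht
  have hcfg : t • y = fun i => t • y i := rfl
  rw [hcfg]
  simpa only [hD] using h

/-- **Axial rotation: `DD_n(y)[(⟪e₂,yᵢ⟫e₁ − ⟪e₁,yᵢ⟫e₂)ᵢ] = 0`** at every non-coincident `y` (the defect is invariant under the isometries
fixing `e₀`, `defectK1_axial_invariant`; Z3'). [cite: FrancescoMathieuSenechal1997, §4.1 (4.19)] -/
theorem limit_fderiv_defectK1_axialRotation_eq_zero (hρ : ∀ δ ∈ Set.Ioc (0:ℝ) 1, 0 < ρ δ)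
    (hlim : HasPointwiseScalingLimit (criticalCorr 3) ρ S)
    (hnorm : ∀ n z, z ∉ NonCoincident 3 n → S n z = 0) (hnd : IsNondegenerateTwoPoint S)
    (heuc : IsEuclideanInvariant S) (hsc : IsScaleCovariant Δ S)
    {n : ℕ} {y : Fin n → EuclideanSpace ℝ (Fin 3)} (hy : y ∈ NonCoincident 3 n) :
    fderiv ℝ (fun x : Fin n → EuclideanSpace ℝ (Fin 3) =>
        fderiv ℝ (S n) x (fun i => ‖x i‖ ^ 2 • (EuclideanSpace.single 0 1 : EuclideanSpace ℝ (Fin 3)) -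
          (2 * inner ℝ (EuclideanSpace.single 0 1 : EuclideanSpace ℝ (Fin 3)) (x i)) • x i) -
        2 * Δ * (∑ i, inner ℝ (EuclideanSpace.single 0 1 : EuclideanSpace ℝ (Fin 3)) (x i)) * S n x) y
      (fun i => inner ℝ (EuclideanSpace.single 2 1 : EuclideanSpace ℝ (Fin 3)) (y i) •
          (EuclideanSpace.single 1 1 : EuclideanSpace ℝ (Fin 3)) -
        inner ℝ (EuclideanSpace.single 1 1 : EuclideanSpace ℝ (Fin 3)) (y i) •
          (EuclideanSpace.single 2 1 : EuclideanSpace ℝ (Fin 3))) = 0 := by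
  set e0 : EuclideanSpace ℝ (Fin 3) := EuclideanSpace.single 0 1 with he0
  set D : (Fin n → EuclideanSpace ℝ (Fin 3)) → ℝ := fun x =>
    fderiv ℝ (S n) x (fun i => ‖x i‖ ^ 2 • e0 - (2 * inner ℝ e0 (x i)) • x i) - 2 * Δ * (∑ i, inner ℝ e0 (x i)) * S n x with hD
  have hDdiff : DifferentiableAt ℝ D y :=
    (analyticOnNhd_defect (analyticOnNhd_limit hρ hlim hnorm hnd heuc hsc n) Δ e0 y hy).differentiableAt
  refine stub_fderiv_axialRotationGenerator n D y hDdiff fun R hR0 z => ?_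
  have h := defectK1_axial_invariant n (S n) Δ (fun R' w => heuc.2 n R' w) R hR0 z
  simpa only [hD] using h

/-- **The order-2 KERNELS of the `K_{e₀}`-defect jet at a critical configuration.**  For an Ising₃ limit as above, at every
non-coincident `x₀` where `DD_n(x₀) = 0` (e.g. the regular horizontal polygon, `…TransitiveJet.lean`), the Hessian of `D_n` kills, in
either slot, every constant (translation) direction `ĉ`, the dilation direction `x₀`, and the axial-rotation direction
`(⟪e₂,x₀ᵢ⟫e₁ − ⟪e₁,x₀ᵢ⟫e₂)ᵢ` (K0 fed by the three first-order identities; `[P,K]`, `[D,K]`, `[M,K]` read on the jet).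
[cite: FrancescoMathieuSenechal1997, §4.1 (4.19)] -/
theorem limit_hessian_defectK1_kernels (hρ : ∀ δ ∈ Set.Ioc (0:ℝ) 1, 0 < ρ δ)
    (hlim : HasPointwiseScalingLimit (criticalCorr 3) ρ S)
    (hnorm : ∀ n z, z ∉ NonCoincident 3 n → S n z = 0) (hnd : IsNondegenerateTwoPoint S)
    (heuc : IsEuclideanInvariant S) (hsc : IsScaleCovariant Δ S)
    {n : ℕ} {x₀ : Fin n → EuclideanSpace ℝ (Fin 3)} (hx₀ : x₀ ∈ NonCoincident 3 n)
    (hD1 : fderiv ℝ (fun x : Fin n → EuclideanSpace ℝ (Fin 3) =>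
        fderiv ℝ (S n) x (fun i => ‖x i‖ ^ 2 • (EuclideanSpace.single 0 1 : EuclideanSpace ℝ (Fin 3)) -
          (2 * inner ℝ (EuclideanSpace.single 0 1 : EuclideanSpace ℝ (Fin 3)) (x i)) • x i) -
        2 * Δ * (∑ i, inner ℝ (EuclideanSpace.single 0 1 : EuclideanSpace ℝ (Fin 3)) (x i)) * S n x) x₀ = 0)
    (m : Fin n → EuclideanSpace ℝ (Fin 3)) (c : EuclideanSpace ℝ (Fin 3)) :
    (iteratedFDeriv ℝ 2 (fun x : Fin n → EuclideanSpace ℝ (Fin 3) =>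
        fderiv ℝ (S n) x (fun i => ‖x i‖ ^ 2 • (EuclideanSpace.single 0 1 : EuclideanSpace ℝ (Fin 3)) -
          (2 * inner ℝ (EuclideanSpace.single 0 1 : EuclideanSpace ℝ (Fin 3)) (x i)) • x i) -
        2 * Δ * (∑ i, inner ℝ (EuclideanSpace.single 0 1 : EuclideanSpace ℝ (Fin 3)) (x i)) * S n x) x₀ ![m, fun _ => c] = 0 ∧
     iteratedFDeriv ℝ 2 (fun x : Fin n → EuclideanSpace ℝ (Fin 3) =>
        fderiv ℝ (S n) x (fun i => ‖x i‖ ^ 2 • (EuclideanSpace.single 0 1 : EuclideanSpace ℝ (Fin 3)) -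
          (2 * inner ℝ (EuclideanSpace.single 0 1 : EuclideanSpace ℝ (Fin 3)) (x i)) • x i) -
        2 * Δ * (∑ i, inner ℝ (EuclideanSpace.single 0 1 : EuclideanSpace ℝ (Fin 3)) (x i)) * S n x) x₀ ![fun _ => c, m] = 0) ∧
    (iteratedFDeriv ℝ 2 (fun x : Fin n → EuclideanSpace ℝ (Fin 3) =>
        fderiv ℝ (S n) x (fun i => ‖x i‖ ^ 2 • (EuclideanSpace.single 0 1 : EuclideanSpace ℝ (Fin 3)) -
          (2 * inner ℝ (EuclideanSpace.single 0 1 : EuclideanSpace ℝ (Fin 3)) (x i)) • x i) -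
        2 * Δ * (∑ i, inner ℝ (EuclideanSpace.single 0 1 : EuclideanSpace ℝ (Fin 3)) (x i)) * S n x) x₀ ![m, x₀] = 0 ∧
     iteratedFDeriv ℝ 2 (fun x : Fin n → EuclideanSpace ℝ (Fin 3) =>
        fderiv ℝ (S n) x (fun i => ‖x i‖ ^ 2 • (EuclideanSpace.single 0 1 : EuclideanSpace ℝ (Fin 3)) -
          (2 * inner ℝ (EuclideanSpace.single 0 1 : EuclideanSpace ℝ (Fin 3)) (x i)) • x i) -
        2 * Δ * (∑ i, inner ℝ (EuclideanSpace.single 0 1 : EuclideanSpace ℝ (Fin 3)) (x i)) * S n x) x₀ ![x₀, m] = 0) ∧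
    (iteratedFDeriv ℝ 2 (fun x : Fin n → EuclideanSpace ℝ (Fin 3) =>
        fderiv ℝ (S n) x (fun i => ‖x i‖ ^ 2 • (EuclideanSpace.single 0 1 : EuclideanSpace ℝ (Fin 3)) -
          (2 * inner ℝ (EuclideanSpace.single 0 1 : EuclideanSpace ℝ (Fin 3)) (x i)) • x i) -
        2 * Δ * (∑ i, inner ℝ (EuclideanSpace.single 0 1 : EuclideanSpace ℝ (Fin 3)) (x i)) * S n x) x₀
        ![m, fun i => inner ℝ (EuclideanSpace.single 2 1 : EuclideanSpace ℝ (Fin 3)) (x₀ i) •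
            (EuclideanSpace.single 1 1 : EuclideanSpace ℝ (Fin 3)) -
          inner ℝ (EuclideanSpace.single 1 1 : EuclideanSpace ℝ (Fin 3)) (x₀ i) •
            (EuclideanSpace.single 2 1 : EuclideanSpace ℝ (Fin 3))] = 0 ∧
     iteratedFDeriv ℝ 2 (fun x : Fin n → EuclideanSpace ℝ (Fin 3) =>
        fderiv ℝ (S n) x (fun i => ‖x i‖ ^ 2 • (EuclideanSpace.single 0 1 : EuclideanSpace ℝ (Fin 3)) -
          (2 * inner ℝ (EuclideanSpace.single 0 1 : EuclideanSpace ℝ (Fin 3)) (x i)) • x i) -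
        2 * Δ * (∑ i, inner ℝ (EuclideanSpace.single 0 1 : EuclideanSpace ℝ (Fin 3)) (x i)) * S n x) x₀
        ![fun i => inner ℝ (EuclideanSpace.single 2 1 : EuclideanSpace ℝ (Fin 3)) (x₀ i) •
            (EuclideanSpace.single 1 1 : EuclideanSpace ℝ (Fin 3)) -
          inner ℝ (EuclideanSpace.single 1 1 : EuclideanSpace ℝ (Fin 3)) (x₀ i) •
            (EuclideanSpace.single 2 1 : EuclideanSpace ℝ (Fin 3)), m] = 0) := by
  set e0 : EuclideanSpace ℝ (Fin 3) := EuclideanSpace.single 0 1 with he0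
  set D : (Fin n → EuclideanSpace ℝ (Fin 3)) → ℝ := fun x =>
    fderiv ℝ (S n) x (fun i => ‖x i‖ ^ 2 • e0 - (2 * inner ℝ e0 (x i)) • x i) - 2 * Δ * (∑ i, inner ℝ e0 (x i)) * S n x with hD
  have hDan : AnalyticOnNhd ℝ D (NonCoincident 3 n) :=
    analyticOnNhd_defect (analyticOnNhd_limit hρ hlim hnorm hnd heuc hsc n) Δ e0
  have hC2 : ContDiffAt ℝ 2 D x₀ := (hDan x₀ hx₀).contDiffAt
  have hnhds : ∀ᶠ y in 𝓝 x₀, y ∈ NonCoincident 3 n := (isOpen_nonCoincident 3 n).mem_nhds hx₀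
  -- the three first-order identities near `x₀`, in the shape of K0
  -- translation: `A = 0`, field `ĉ`, `a = 0`
  set Cc : Fin n → EuclideanSpace ℝ (Fin 3) := fun _ => c with hCc
  have hT : ∀ᶠ y in 𝓝 x₀, fderiv ℝ D y ((0 : (Fin n → EuclideanSpace ℝ (Fin 3)) →L[ℝ] (Fin n → EuclideanSpace ℝ (Fin 3))) y + Cc) =
      0 * D y := by
    filter_upwards [hnhds] with y hy
    rw [zero_apply, zero_add, zero_mul]
    exact limit_fderiv_defectK1_const_eq_zero hρ hlim hnorm hnd heuc hsc hy c
  -- dilation: `A = id`, `c = 0`, `a = 1 − nΔ`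
  have hDil : ∀ᶠ y in 𝓝 x₀, fderiv ℝ D y ((ContinuousLinearMap.id ℝ (Fin n → EuclideanSpace ℝ (Fin 3))) y + 0) =
      (1 - (n : ℝ) * Δ) * D y := by
    filter_upwards [hnhds] with y hy
    rw [ContinuousLinearMap.id_apply, add_zero]
    exact limit_fderiv_defectK1_self hρ hlim hnorm hnd heuc hsc hy
  -- axial rotation: `A = M̂`, `c = 0`, `a = 0`
  set M : (Fin n → EuclideanSpace ℝ (Fin 3)) →L[ℝ] (Fin n → EuclideanSpace ℝ (Fin 3)) :=
    ContinuousLinearMap.pi fun i =>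
      ((innerSL ℝ (EuclideanSpace.single 2 1 : EuclideanSpace ℝ (Fin 3))).smulRight
            (EuclideanSpace.single 1 1 : EuclideanSpace ℝ (Fin 3)) -
          (innerSL ℝ (EuclideanSpace.single 1 1 : EuclideanSpace ℝ (Fin 3))).smulRight
            (EuclideanSpace.single 2 1 : EuclideanSpace ℝ (Fin 3))).comp
        (ContinuousLinearMap.proj i) with hM
  have hMapply : ∀ y : Fin n → EuclideanSpace ℝ (Fin 3), M y = fun i =>
      inner ℝ (EuclideanSpace.single 2 1 : EuclideanSpace ℝ (Fin 3)) (y i) • (EuclideanSpace.single 1 1 : EuclideanSpace ℝ (Fin 3)) -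
        inner ℝ (EuclideanSpace.single 1 1 : EuclideanSpace ℝ (Fin 3)) (y i) • (EuclideanSpace.single 2 1 : EuclideanSpace ℝ (Fin 3)) :=
    fun y => by
      funext i
      simp [hM, ContinuousLinearMap.smulRight_apply, innerSL_apply_apply]
  have hRot : ∀ᶠ y in 𝓝 x₀, fderiv ℝ D y (M y + 0) = 0 * D y := by
    filter_upwards [hnhds] with y hy
    rw [add_zero, zero_mul, hMapply]
    exact limit_fderiv_defectK1_axialRotation_eq_zero hρ hlim hnorm hnd heuc hsc hy
  have kT := stub_hessian_apply_eq_zero_of_fderiv_identity n D x₀ 0 Cc 0 hC2 hD1 hT m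
  have kD := stub_hessian_apply_eq_zero_of_fderiv_identity n D x₀ (ContinuousLinearMap.id ℝ _) 0 (1 - (n : ℝ) * Δ) hC2 hD1 hDil m
  have kR := stub_hessian_apply_eq_zero_of_fderiv_identity n D x₀ M 0 0 hC2 hD1 hRot m
  simp only [zero_apply, zero_add, ContinuousLinearMap.id_apply, add_zero, hMapply] at kT kD kR
  exact ⟨kT, kD, kR⟩


/-- **At the unit regular horizontal `n`-gon the order-2 kernels hold unconditionally** (`DD_n(P_n) = 0` by transitivity,
`…TransitiveJet.lean`). [cite: FrancescoMathieuSenechal1997, §4.1 (4.19)] -/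
theorem limit_hessian_defectK1_kernels_at_regularPolygon (hρ : ∀ δ ∈ Set.Ioc (0:ℝ) 1, 0 < ρ δ)
    (hlim : HasPointwiseScalingLimit (criticalCorr 3) ρ S)
    (hnorm : ∀ n z, z ∉ NonCoincident 3 n → S n z = 0) (hnd : IsNondegenerateTwoPoint S)
    (heuc : IsEuclideanInvariant S) (hsc : IsScaleCovariant Δ S) (n : ℕ)
    (m : Fin n → EuclideanSpace ℝ (Fin 3)) (c : EuclideanSpace ℝ (Fin 3)) :
    (iteratedFDeriv ℝ 2 (fun x : Fin n → EuclideanSpace ℝ (Fin 3) =>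
        fderiv ℝ (S n) x (fun i => ‖x i‖ ^ 2 • (EuclideanSpace.single 0 1 : EuclideanSpace ℝ (Fin 3)) -
          (2 * inner ℝ (EuclideanSpace.single 0 1 : EuclideanSpace ℝ (Fin 3)) (x i)) • x i) -
        2 * Δ * (∑ i, inner ℝ (EuclideanSpace.single 0 1 : EuclideanSpace ℝ (Fin 3)) (x i)) * S n x) (fun i : Fin n => Real.cos (2 * Real.pi * ((i : ℕ) : ℝ) / (n : ℝ)) • (EuclideanSpace.single 1 1 : EuclideanSpace ℝ (Fin 3)) +
        Real.sin (2 * Real.pi * ((i : ℕ) : ℝ) / (n : ℝ)) • (EuclideanSpace.single 2 1 : EuclideanSpace ℝ (Fin 3))) ![m, fun _ => c] = 0 ∧ iteratedFDeriv ℝ 2 (fun x : Fin n → EuclideanSpace ℝ (Fin 3) =>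
        fderiv ℝ (S n) x (fun i => ‖x i‖ ^ 2 • (EuclideanSpace.single 0 1 : EuclideanSpace ℝ (Fin 3)) -
          (2 * inner ℝ (EuclideanSpace.single 0 1 : EuclideanSpace ℝ (Fin 3)) (x i)) • x i) -
        2 * Δ * (∑ i, inner ℝ (EuclideanSpace.single 0 1 : EuclideanSpace ℝ (Fin 3)) (x i)) * S n x) (fun i : Fin n => Real.cos (2 * Real.pi * ((i : ℕ) : ℝ) / (n : ℝ)) • (EuclideanSpace.single 1 1 : EuclideanSpace ℝ (Fin 3)) +
        Real.sin (2 * Real.pi * ((i : ℕ) : ℝ) / (n : ℝ)) • (EuclideanSpace.single 2 1 : EuclideanSpace ℝ (Fin 3))) ![fun _ => c, m] = 0) ∧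
    (iteratedFDeriv ℝ 2 (fun x : Fin n → EuclideanSpace ℝ (Fin 3) =>
        fderiv ℝ (S n) x (fun i => ‖x i‖ ^ 2 • (EuclideanSpace.single 0 1 : EuclideanSpace ℝ (Fin 3)) -
          (2 * inner ℝ (EuclideanSpace.single 0 1 : EuclideanSpace ℝ (Fin 3)) (x i)) • x i) -
        2 * Δ * (∑ i, inner ℝ (EuclideanSpace.single 0 1 : EuclideanSpace ℝ (Fin 3)) (x i)) * S n x) (fun i : Fin n => Real.cos (2 * Real.pi * ((i : ℕ) : ℝ) / (n : ℝ)) • (EuclideanSpace.single 1 1 : EuclideanSpace ℝ (Fin 3)) +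
        Real.sin (2 * Real.pi * ((i : ℕ) : ℝ) / (n : ℝ)) • (EuclideanSpace.single 2 1 : EuclideanSpace ℝ (Fin 3))) ![m, (fun i : Fin n => Real.cos (2 * Real.pi * ((i : ℕ) : ℝ) / (n : ℝ)) • (EuclideanSpace.single 1 1 : EuclideanSpace ℝ (Fin 3)) +
        Real.sin (2 * Real.pi * ((i : ℕ) : ℝ) / (n : ℝ)) • (EuclideanSpace.single 2 1 : EuclideanSpace ℝ (Fin 3)))] = 0 ∧ iteratedFDeriv ℝ 2 (fun x : Fin n → EuclideanSpace ℝ (Fin 3) =>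
        fderiv ℝ (S n) x (fun i => ‖x i‖ ^ 2 • (EuclideanSpace.single 0 1 : EuclideanSpace ℝ (Fin 3)) -
          (2 * inner ℝ (EuclideanSpace.single 0 1 : EuclideanSpace ℝ (Fin 3)) (x i)) • x i) -
        2 * Δ * (∑ i, inner ℝ (EuclideanSpace.single 0 1 : EuclideanSpace ℝ (Fin 3)) (x i)) * S n x) (fun i : Fin n => Real.cos (2 * Real.pi * ((i : ℕ) : ℝ) / (n : ℝ)) • (EuclideanSpace.single 1 1 : EuclideanSpace ℝ (Fin 3)) +
        Real.sin (2 * Real.pi * ((i : ℕ) : ℝ) / (n : ℝ)) • (EuclideanSpace.single 2 1 : EuclideanSpace ℝ (Fin 3))) ![(fun i : Fin n => Real.cos (2 * Real.pi * ((i : ℕ) : ℝ) / (n : ℝ)) • (EuclideanSpace.single 1 1 : EuclideanSpace ℝ (Fin 3)) +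
        Real.sin (2 * Real.pi * ((i : ℕ) : ℝ) / (n : ℝ)) • (EuclideanSpace.single 2 1 : EuclideanSpace ℝ (Fin 3))), m] = 0) ∧
    (iteratedFDeriv ℝ 2 (fun x : Fin n → EuclideanSpace ℝ (Fin 3) =>
        fderiv ℝ (S n) x (fun i => ‖x i‖ ^ 2 • (EuclideanSpace.single 0 1 : EuclideanSpace ℝ (Fin 3)) -
          (2 * inner ℝ (EuclideanSpace.single 0 1 : EuclideanSpace ℝ (Fin 3)) (x i)) • x i) -
        2 * Δ * (∑ i, inner ℝ (EuclideanSpace.single 0 1 : EuclideanSpace ℝ (Fin 3)) (x i)) * S n x) (fun i : Fin n => Real.cos (2 * Real.pi * ((i : ℕ) : ℝ) / (n : ℝ)) • (EuclideanSpace.single 1 1 : EuclideanSpace ℝ (Fin 3)) +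
        Real.sin (2 * Real.pi * ((i : ℕ) : ℝ) / (n : ℝ)) • (EuclideanSpace.single 2 1 : EuclideanSpace ℝ (Fin 3)))
        ![m, fun i => inner ℝ (EuclideanSpace.single 2 1 : EuclideanSpace ℝ (Fin 3)) ((fun i : Fin n => Real.cos (2 * Real.pi * ((i : ℕ) : ℝ) / (n : ℝ)) • (EuclideanSpace.single 1 1 : EuclideanSpace ℝ (Fin 3)) +
        Real.sin (2 * Real.pi * ((i : ℕ) : ℝ) / (n : ℝ)) • (EuclideanSpace.single 2 1 : EuclideanSpace ℝ (Fin 3))) i) •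
            (EuclideanSpace.single 1 1 : EuclideanSpace ℝ (Fin 3)) -
          inner ℝ (EuclideanSpace.single 1 1 : EuclideanSpace ℝ (Fin 3)) ((fun i : Fin n => Real.cos (2 * Real.pi * ((i : ℕ) : ℝ) / (n : ℝ)) • (EuclideanSpace.single 1 1 : EuclideanSpace ℝ (Fin 3)) +
        Real.sin (2 * Real.pi * ((i : ℕ) : ℝ) / (n : ℝ)) • (EuclideanSpace.single 2 1 : EuclideanSpace ℝ (Fin 3))) i) •
            (EuclideanSpace.single 2 1 : EuclideanSpace ℝ (Fin 3))] = 0 ∧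
     iteratedFDeriv ℝ 2 (fun x : Fin n → EuclideanSpace ℝ (Fin 3) =>
        fderiv ℝ (S n) x (fun i => ‖x i‖ ^ 2 • (EuclideanSpace.single 0 1 : EuclideanSpace ℝ (Fin 3)) -
          (2 * inner ℝ (EuclideanSpace.single 0 1 : EuclideanSpace ℝ (Fin 3)) (x i)) • x i) -
        2 * Δ * (∑ i, inner ℝ (EuclideanSpace.single 0 1 : EuclideanSpace ℝ (Fin 3)) (x i)) * S n x) (fun i : Fin n => Real.cos (2 * Real.pi * ((i : ℕ) : ℝ) / (n : ℝ)) • (EuclideanSpace.single 1 1 : EuclideanSpace ℝ (Fin 3)) +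
        Real.sin (2 * Real.pi * ((i : ℕ) : ℝ) / (n : ℝ)) • (EuclideanSpace.single 2 1 : EuclideanSpace ℝ (Fin 3)))
        ![fun i => inner ℝ (EuclideanSpace.single 2 1 : EuclideanSpace ℝ (Fin 3)) ((fun i : Fin n => Real.cos (2 * Real.pi * ((i : ℕ) : ℝ) / (n : ℝ)) • (EuclideanSpace.single 1 1 : EuclideanSpace ℝ (Fin 3)) +
        Real.sin (2 * Real.pi * ((i : ℕ) : ℝ) / (n : ℝ)) • (EuclideanSpace.single 2 1 : EuclideanSpace ℝ (Fin 3))) i) •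
            (EuclideanSpace.single 1 1 : EuclideanSpace ℝ (Fin 3)) -
          inner ℝ (EuclideanSpace.single 1 1 : EuclideanSpace ℝ (Fin 3)) ((fun i : Fin n => Real.cos (2 * Real.pi * ((i : ℕ) : ℝ) / (n : ℝ)) • (EuclideanSpace.single 1 1 : EuclideanSpace ℝ (Fin 3)) +
        Real.sin (2 * Real.pi * ((i : ℕ) : ℝ) / (n : ℝ)) • (EuclideanSpace.single 2 1 : EuclideanSpace ℝ (Fin 3))) i) •
            (EuclideanSpace.single 2 1 : EuclideanSpace ℝ (Fin 3)), m] = 0) :=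
  limit_hessian_defectK1_kernels hρ hlim hnorm hnd heuc hsc (stub_regularPolygon_mem_nonCoincident n)
    (limit_fderiv_defectK1_eq_zero_at_regularPolygon hρ hlim hnorm hnd heuc hsc n) m c

/-- **Dihedral (rotation) invariance of the jet at the regular polygon**: for every Ising₃ limit as above, every `n`, every order `k`,
the `k`-th Taylor coefficient of `D_n` at `P_n` is invariant under rotating every direction by `2π/n` about `e₀` and relabelling
cyclically (N1b's rotation `R`, `R P_nᵢ = P_n(i+1)`; `jetK1_comp_symmetry`). [cite: FrancescoMathieuSenechal1997, §4.1 (4.18)–(4.19)] -/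
theorem limit_jetK1_rotation_invariant_at_regularPolygon
    (hlim : HasPointwiseScalingLimit (criticalCorr 3) ρ S)
    (hnorm : ∀ n z, z ∉ NonCoincident 3 n → S n z = 0) (heuc : IsEuclideanInvariant S) (n : ℕ) :
    ∃ R : EuclideanSpace ℝ (Fin 3) ≃ₗᵢ[ℝ] EuclideanSpace ℝ (Fin 3),
      R (EuclideanSpace.single 0 1) = EuclideanSpace.single 0 1 ∧
      (∀ i : Fin n, R ((fun i : Fin n => Real.cos (2 * Real.pi * ((i : ℕ) : ℝ) / (n : ℝ)) • (EuclideanSpace.single 1 1 : EuclideanSpace ℝ (Fin 3)) +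
        Real.sin (2 * Real.pi * ((i : ℕ) : ℝ) / (n : ℝ)) • (EuclideanSpace.single 2 1 : EuclideanSpace ℝ (Fin 3))) i) = (fun i : Fin n => Real.cos (2 * Real.pi * ((i : ℕ) : ℝ) / (n : ℝ)) • (EuclideanSpace.single 1 1 : EuclideanSpace ℝ (Fin 3)) +
        Real.sin (2 * Real.pi * ((i : ℕ) : ℝ) / (n : ℝ)) • (EuclideanSpace.single 2 1 : EuclideanSpace ℝ (Fin 3))) (finRotate n i)) ∧
      ∀ (k : ℕ) (m : Fin k → Fin n → EuclideanSpace ℝ (Fin 3)),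
        iteratedFDeriv ℝ k (fun x : Fin n → EuclideanSpace ℝ (Fin 3) =>
        fderiv ℝ (S n) x (fun i => ‖x i‖ ^ 2 • (EuclideanSpace.single 0 1 : EuclideanSpace ℝ (Fin 3)) -
          (2 * inner ℝ (EuclideanSpace.single 0 1 : EuclideanSpace ℝ (Fin 3)) (x i)) • x i) -
        2 * Δ * (∑ i, inner ℝ (EuclideanSpace.single 0 1 : EuclideanSpace ℝ (Fin 3)) (x i)) * S n x) (fun i : Fin n => Real.cos (2 * Real.pi * ((i : ℕ) : ℝ) / (n : ℝ)) • (EuclideanSpace.single 1 1 : EuclideanSpace ℝ (Fin 3)) +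
        Real.sin (2 * Real.pi * ((i : ℕ) : ℝ) / (n : ℝ)) • (EuclideanSpace.single 2 1 : EuclideanSpace ℝ (Fin 3))) (fun j i => R (m j ((finRotate n).symm i))) = iteratedFDeriv ℝ k (fun x : Fin n → EuclideanSpace ℝ (Fin 3) =>
        fderiv ℝ (S n) x (fun i => ‖x i‖ ^ 2 • (EuclideanSpace.single 0 1 : EuclideanSpace ℝ (Fin 3)) -
          (2 * inner ℝ (EuclideanSpace.single 0 1 : EuclideanSpace ℝ (Fin 3)) (x i)) • x i) -
        2 * Δ * (∑ i, inner ℝ (EuclideanSpace.single 0 1 : EuclideanSpace ℝ (Fin 3)) (x i)) * S n x) (fun i : Fin n => Real.cos (2 * Real.pi * ((i : ℕ) : ℝ) / (n : ℝ)) • (EuclideanSpace.single 1 1 : EuclideanSpace ℝ (Fin 3)) +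
        Real.sin (2 * Real.pi * ((i : ℕ) : ℝ) / (n : ℝ)) • (EuclideanSpace.single 2 1 : EuclideanSpace ℝ (Fin 3))) m := by
  obtain ⟨R, hR0, hRP⟩ := stub_regularPolygon_rotation n
  refine ⟨R, hR0, fun i => hRP i, fun k m => ?_⟩
  have hperm := isPermutationSymmetric_of_limit hlim hnorm
  exact jetK1_comp_symmetry n (S n) Δ (fun R' y => heuc.2 n R' y) (fun σ y => hperm n σ y) R hR0 (finRotate n) _
    (fun i => hRP i) k m

end Limit

/-! ## Registered anchor -/

/-- **Registered anchor of this file — the order-2 kernels of the `K_{e₀}` Ward-defect jet of the Ising₃ `n`-point limit at the unit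
regular horizontal `n`-gon: translations, dilation, axial rotation** (explicit-binder form; first slot). [cite: FrancescoMathieuSenechal1997, §4.1 (4.19)] -/
theorem limit_sctDefectK1_hessian_kernels_at_regularPolygon : ∀ (ρ : ℝ → ℝ) (Δ : ℝ) (S : Literature.Probability.LatticeModels.CorrFamily 3), (∀ δ ∈ Set.Ioc (0:ℝ) 1, 0 < ρ δ) → Literature.Probability.LatticeModels.HasPointwiseScalingLimit (Literature.Probability.LatticeModels.criticalCorr 3) ρ S → (∀ n z, z ∉ Literature.Probability.LatticeModels.NonCoincident 3 n → S n z = 0) → Literature.Probability.LatticeModels.IsNondegenerateTwoPoint S → Literature.Probability.LatticeModels.IsEuclideanInvariant S → Literature.Probability.LatticeModels.IsScaleCovariant Δ S → ∀ (n : ℕ) (m : Fin n → EuclideanSpace ℝ (Fin 3)) (c : EuclideanSpace ℝ (Fin 3)), iteratedFDeriv ℝ 2 (fun x : Fin n → EuclideanSpace ℝ (Fin 3) => fderiv ℝ (S n) x (fun i => ‖x i‖ ^ 2 • (EuclideanSpace.single 0 1 : EuclideanSpace ℝ (Fin 3)) - (2 * inner ℝ (EuclideanSpace.single 0 1 : EuclideanSpace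 ℝ (Fin 3)) (x i)) • x i) - 2 * Δ * (∑ i, inner ℝ (EuclideanSpace.single 0 1 : EuclideanSpace ℝ (Fin 3)) (x i)) * S n x) (fun i : Fin n => Real.cos (2 * Real.pi * ((i : ℕ) : ℝ) / (n : ℝ)) • (EuclideanSpace.single 1 1 : EuclideanSpace ℝ (Fin 3)) + Real.sin (2 * Real.pi * ((i : ℕ) : ℝ) / (n : ℝ)) • (EuclideanSpace.single 2 1 : EuclideanSpace ℝ (Fin 3))) ![m, fun _ => c] = 0 ∧ iteratedFDeriv ℝ 2 (fun x : Fin n → EuclideanSpace ℝ (Fin 3) => fderiv ℝ (S n) x (fun i => ‖x i‖ ^ 2 • (EuclideanSpace.single 0 1 : EuclideanSpace ℝ (Fin 3)) - (2 * inner ℝ (EuclideanSpace.single 0 1 : EuclideanSpace ℝ (Fin 3)) (x i)) • x i) - 2 * Δ * (∑ i, inner ℝ (EuclideanSpace.single 0 1 : EuclideanSpace ℝ (Fin 3)) (x i)) * S n x) (fun i : Fin n => Real.cos (2 * Real.pi * ((i : ℕ) : ℝ) / (n : ℝ)) • (EuclideanSpace.single 1 1 : EuclideanSpace ℝ (Fin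 3)) + Real.sin (2 * Real.pi * ((i : ℕ) : ℝ) / (n : ℝ)) • (EuclideanSpace.single 2 1 : EuclideanSpace ℝ (Fin 3))) ![m, fun i : Fin n => Real.cos (2 * Real.pi * ((i : ℕ) : ℝ) / (n : ℝ)) • (EuclideanSpace.single 1 1 : EuclideanSpace ℝ (Fin 3)) + Real.sin (2 * Real.pi * ((i : ℕ) : ℝ) / (n : ℝ)) • (EuclideanSpace.single 2 1 : EuclideanSpace ℝ (Fin 3))] = 0 ∧ iteratedFDeriv ℝ 2 (fun x : Fin n → EuclideanSpace ℝ (Fin 3) => fderiv ℝ (S n) x (fun i => ‖x i‖ ^ 2 • (EuclideanSpace.single 0 1 : EuclideanSpace ℝ (Fin 3)) - (2 * inner ℝ (EuclideanSpace.single 0 1 : EuclideanSpace ℝ (Fin 3)) (x i)) • x i) - 2 * Δ * (∑ i, inner ℝ (EuclideanSpace.single 0 1 : EuclideanSpace ℝ (Fin 3)) (x i)) * S n x) (fun i : Fin n => Real.cos (2 * Real.pi * ((i : ℕ) : ℝ) / (n : ℝ)) • (EuclideanSpace.single 1 1 : EuclideanSpace ℝ (Fin 3)) + Real.sin (2 *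 Real.pi * ((i : ℕ) : ℝ) / (n : ℝ)) • (EuclideanSpace.single 2 1 : EuclideanSpace ℝ (Fin 3))) ![m, fun i : Fin n => inner ℝ (EuclideanSpace.single 2 1 : EuclideanSpace ℝ (Fin 3)) (Real.cos (2 * Real.pi * ((i : ℕ) : ℝ) / (n : ℝ)) • (EuclideanSpace.single 1 1 : EuclideanSpace ℝ (Fin 3)) + Real.sin (2 * Real.pi * ((i : ℕ) : ℝ) / (n : ℝ)) • (EuclideanSpace.single 2 1 : EuclideanSpace ℝ (Fin 3))) • (EuclideanSpace.single 1 1 : EuclideanSpace ℝ (Fin 3)) - inner ℝ (EuclideanSpace.single 1 1 : EuclideanSpace ℝ (Fin 3)) (Real.cos (2 * Real.pi * ((i : ℕ) : ℝ) / (n : ℝ)) • (EuclideanSpace.single 1 1 : EuclideanSpace ℝ (Fin 3)) + Real.sin (2 * Real.pi * ((i : ℕ) : ℝ) / (n : ℝ)) • (EuclideanSpace.single 2 1 : EuclideanSpace ℝ (Fin 3))) • (EuclideanSpace.single 2 1 : EuclideanSpace ℝ (Fin 3))] = 0 :=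
  fun _ _ _ hρ hlim hnorm hnd heuc hsc n m c =>
    let h := limit_hessian_defectK1_kernels_at_regularPolygon hρ hlim hnorm hnd heuc hsc n m c
    ⟨h.1.1, h.2.1.1, h.2.2.1⟩

end Summit.CriticalPhenomena.Ising3DConformalLimit.MoebiusLimitExistsHessianKernels

end
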